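import Literature.Barriers.ValiantsHypothesis.MonotoneGapPermanentUpper
import Literature.Computability.AlgebraicComplexity.ArithCircuitProofs
import Literature.Combinatorics.Expanders.Concentrator
import Summits.ValiantsHypothesis.ValiantsHypothesis.Theorems.StatementJunkGuardArithCircuitExistsComputesProved

/-!
# Route SummationBits, item `PositiveWitnessConstruction` (stmt-ValiantsHypothesis-10489) — preliminaries:
a cost calculus for Jerrum–Snir monotone computations, the size of the permanental Laplace circuit,
and the elementary estimates of the positive rung

Helpers for the positive rung of the summation-bits dial (Theorem A of card summation-bits-ladder,
construction half; the item is closed in `SummationBitsPositiveWitnessConstruction.lean`).  The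
witness of `PositiveWitnessConstruction` is a product of block permanents, each computed by the
tree's Jerrum–Snir Laplace-expansion circuit
`Literature.Barriers.ValiantsHypothesis.JerrumSnir.laplaceCircuit` (J. ACM 29 (1982), §4.3, p. 889).
This file provides:

* a small calculus of *sized monotone computations* `∃ P, IsMonotoneComputation P f ∧ P.size ≤ s`
  (plain fan-in-two circuits over `ℝ≥0`, `MonotoneGap.lean`): closure under renaming of the
  variables, binary products (`ArithCircuit.mul`, semantics `ArithCircuit.eval_mul_holds`) and
  finite products (`exists_isMonotoneComputation_list_prod`, `…_prod_fin`);
* `size_laplaceCircuit_le`: the Laplace circuit for `per_n` has at most `n · 2^n` gates (the tree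
  records only its number of PRODUCT gates, `n (2^{n-1} - 1)`; each emitted product gate is
  followed by at most one plain sum gate, so the gate count is at most twice that);
* the arithmetic of the rung with the constant `C = 5`: `(k+1)^n ≤ 2^{5n} (k!)^q` for `n = qk + r`,
  `r < k`, `2^k ≤ n` (`succ_pow_le_two_pow_mul_factorial_pow`, via `k^k ≤ 3^k k!` — the tree's
  `Literature.Combinatorics.Expanders.pow_self_le_three_pow_mul_factorial` — and
  `k^r ≤ 4^n`), its real form `2^{n log₂log₂ n - 5n} ≤ N` once `(k!)^q ≤ N` and `log₂ n < k + 1`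
  (`two_rpow_loglog_le`), the size bound `q(k 2^k) + q + r + 1 ≤ n^5 + 5` (`blockSize_le`), and
  `log₂ n < ⌊log₂ n⌋ + 1` (`logb_lt_natLog_add_one`).

No new definitions; everything is stated with the tree's `IsMonotoneComputation`, `IsPlain`,
`ArithCircuit.size`.
-/

noncomputable section

namespace Summit.ValiantsHypothesis.Theorems.SummationBits

open Literature.Computability.AlgebraicComplexity MvPolynomial
open Literature.Barriers.ValiantsHypothesis
open ArithCircuit (Gate Operand)
open scoped NNReal

universe u v w

variable {σ : Type u} {τ : Type v}

/-! ### Plain gates under shifting and renaming -/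

/-- Shifting the gate references of a gate keeps it plain (coefficients are untouched). [folklore] -/
theorem isPlainGate_shift {k : Type w} [One k] {g : Gate k σ} (h : IsPlainGate g) (m : ℕ) :
    IsPlainGate (g.shift m) := by
  cases g with
  | sum args =>
    intro a ha
    simp only [List.mem_map] at ha
    obtain ⟨a', ha', rfl⟩ := ha
    exact h a' ha'
  | prod args => trivial

/-- Renaming the variables of a gate keeps it plain (coefficients are untouched). [folklore] -/
theorem isPlainGate_rename {k : Type w} [One k] {g : Gate k σ} (h : IsPlainGate g) (e : σ → τ) :
    IsPlainGate (g.rename e) := by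
  cases g with
  | sum args =>
    intro a ha
    simp only [List.mem_map] at ha
    obtain ⟨a', ha', rfl⟩ := ha
    exact h a' ha'
  | prod args => trivial

/-- The product combinator `ArithCircuit.mul` of two plain circuits is plain: its gates are those of
`P`, those of `Q` shifted, and one product gate. [folklore] -/
theorem isPlain_mul {P Q : ArithCircuit ℝ≥0 σ} (hP : IsPlain P) (hQ : IsPlain Q) : IsPlain (P.mul Q) := by
  intro g hg
  simp only [ArithCircuit.mul, ArithCircuit.append, List.mem_append, List.mem_map,
    List.mem_singleton] at hg
  rcases hg with (hg | ⟨g0, hg0, rfl⟩) | rfl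
  · exact hP g hg
  · exact isPlainGate_shift (hQ g0 hg0) _
  · trivial

/-- Renaming the variables of a plain circuit gives a plain circuit. [folklore] -/
theorem isPlain_rename {P : ArithCircuit ℝ≥0 σ} (hP : IsPlain P) (e : σ → τ) : IsPlain (P.rename e) := by
  intro g hg
  simp only [ArithCircuit.rename, List.mem_map] at hg
  obtain ⟨g0, hg0, rfl⟩ := hg
  exact isPlainGate_rename (hP g0 hg0) e

/-! ### Sized monotone computations -/

/-- A variable is a monotone computation of size `0`. [folklore] -/
theorem exists_isMonotoneComputation_X (i : σ) :
    ∃ P : ArithCircuit ℝ≥0 σ, IsMonotoneComputation P (X i) ∧ P.size ≤ 0 :=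
  ⟨ArithCircuit.ofVar i, (isMonotoneComputation_ofVar i).1, le_rfl⟩

/-- The constant `1` is a monotone computation of size `0` (the gate-free circuit `ofConst 1`). [folklore] -/
theorem exists_isMonotoneComputation_one :
    ∃ P : ArithCircuit ℝ≥0 σ, IsMonotoneComputation P (1 : MvPolynomial σ ℝ≥0) ∧ P.size ≤ 0 := by
  refine ⟨ArithCircuit.ofConst 1, ⟨ArithCircuit.IsFanInTwo.ofConst 1, ?_, ?_⟩, le_rfl⟩
  · intro g hg; simp [ArithCircuit.ofConst] at hg
  · show (ArithCircuit.ofConst (1 : ℝ≥0) : ArithCircuit ℝ≥0 σ).eval = 1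
    rw [ArithCircuit.eval_ofConst, C_1]

/-- Sized monotone computations are closed under products, at the cost of one product gate
(`ArithCircuit.mul`, `eval_mul_holds`). [folklore] -/
theorem exists_isMonotoneComputation_mul {f g : MvPolynomial σ ℝ≥0} {s t : ℕ}
    (hf : ∃ P : ArithCircuit ℝ≥0 σ, IsMonotoneComputation P f ∧ P.size ≤ s)
    (hg : ∃ P : ArithCircuit ℝ≥0 σ, IsMonotoneComputation P g ∧ P.size ≤ t) :
    ∃ P : ArithCircuit ℝ≥0 σ, IsMonotoneComputation P (f * g) ∧ P.size ≤ s + t + 1 := by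
  obtain ⟨P, ⟨hP1, hP2, hP3⟩, hPs⟩ := hf
  obtain ⟨Q, ⟨hQ1, hQ2, hQ3⟩, hQs⟩ := hg
  refine ⟨P.mul Q, ⟨hP1.mul hQ1, isPlain_mul hP2 hQ2, ?_⟩, ?_⟩
  · show (P.mul Q).eval = f * g
    rw [ArithCircuit.eval_mul_holds P Q, hP3, hQ3]
  · rw [ArithCircuit.size_mul]; omega

/-- Sized monotone computations are stable under renaming of the variables (same size). [folklore] -/
theorem exists_isMonotoneComputation_rename {f : MvPolynomial σ ℝ≥0} {s : ℕ}
    (hf : ∃ P : ArithCircuit ℝ≥0 σ, IsMonotoneComputation P f ∧ P.size ≤ s) (e : σ → τ) :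
    ∃ P : ArithCircuit ℝ≥0 τ, IsMonotoneComputation P (rename e f) ∧ P.size ≤ s := by
  obtain ⟨P, ⟨hP1, hP2, hP3⟩, hPs⟩ := hf
  refine ⟨P.rename e, ⟨hP1.rename e, isPlain_rename hP2 e, hP3.rename e⟩, ?_⟩
  rw [ArithCircuit.size_rename]; exact hPs

/-- Finite products, list form: if each `f i` (`i ∈ l`) has a monotone computation of size `≤ s i`
then `∏_{i ∈ l} f i` has one of size `≤ Σ_{i ∈ l} s i + |l|`. [folklore] -/
theorem exists_isMonotoneComputation_list_prod {ι : Type w} (l : List ι)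
    (f : ι → MvPolynomial σ ℝ≥0) (s : ι → ℕ)
    (h : ∀ i ∈ l, ∃ P : ArithCircuit ℝ≥0 σ, IsMonotoneComputation P (f i) ∧ P.size ≤ s i) :
    ∃ P : ArithCircuit ℝ≥0 σ, IsMonotoneComputation P (l.map f).prod ∧
      P.size ≤ (l.map s).sum + l.length := by
  induction l with
  | nil => simpa using (exists_isMonotoneComputation_one (σ := σ))
  | cons i l ih =>
    simp only [List.map_cons, List.sum_cons, List.prod_cons, List.length_cons]
    obtain ⟨P, hP, hPs⟩ := exists_isMonotoneComputation_mul (h i List.mem_cons_self)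
      (ih fun j hj => h j (List.mem_cons_of_mem _ hj))
    exact ⟨P, hP, by omega⟩

/-- Finite products indexed by `Fin m`: size `≤ Σ_i s i + m`. [folklore] -/
theorem exists_isMonotoneComputation_prod_fin {m : ℕ} (f : Fin m → MvPolynomial σ ℝ≥0)
    (s : Fin m → ℕ)
    (h : ∀ i, ∃ P : ArithCircuit ℝ≥0 σ, IsMonotoneComputation P (f i) ∧ P.size ≤ s i) :
    ∃ P : ArithCircuit ℝ≥0 σ, IsMonotoneComputation P (∏ i, f i) ∧ P.size ≤ (∑ i, s i) + m := by
  rw [Fin.prod_univ_def, Fin.sum_univ_def]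
  simpa [List.length_finRange] using
    exists_isMonotoneComputation_list_prod (List.finRange m) f s (fun i _ => h i)


/-! ### The size of the permanental Laplace circuit -/

section Emit

open JerrumSnir

variable {k : Type w} [CommSemiring k] {ι : Type*} (x : ι → σ) (u : ι → Operand k σ)

/-- `emitAcc` appends exactly two gates per element of the list. [cite: JerrumSnir1982, §4.3 (p. 889)] -/
theorem length_emitAcc :
    ∀ (l : List ι) (gs : List (Gate k σ)) (acc : Operand k σ),
      (emitAcc x u gs acc l).1.length = gs.length + 2 * l.length
  | [], gs, acc => by simp [emitAcc]
  | i :: rest, gs, acc => by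
    rw [show emitAcc x u gs acc (i :: rest) =
        emitAcc x u (gs ++ [Gate.prod [.var (x i), u i], Gate.sum [(1, acc), (1, .gate gs.length)]])
          (.gate (gs.length + 1)) rest from rfl, length_emitAcc rest]
    simp only [List.length_append, List.length_cons, List.length_nil]
    ring

/-- `emitSumProd` appends at most two gates per element of the list (exactly `2|l| - 1` for `l ≠ []`).
[cite: JerrumSnir1982, §4.3 (p. 889)] -/
theorem length_emitSumProd_le (l : List ι) (gs : List (Gate k σ)) :
    (emitSumProd x u gs l).1.length ≤ gs.length + 2 * l.length := by
  cases l with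
  | nil => simp [emitSumProd]
  | cons i rest =>
    rw [show emitSumProd x u gs (i :: rest) =
        emitAcc x u (gs ++ [Gate.prod [.var (x i), u i]]) (.gate gs.length) rest from rfl,
      length_emitAcc]
    simp only [List.length_append, List.length_cons, List.length_nil]
    omega

end Emit

section Build

open JerrumSnir Finset

variable {n : ℕ}

/-- Processing one column set `S` adds at most `2|S|` gates. [cite: JerrumSnir1982, §4.3 (p. 889)] -/
theorem length_processSubset_le (r : Fin n) (st : BState n) (S : Finset (Fin n)) :
    (processSubset r st S).gs.length ≤ st.gs.length + 2 * S.card := by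
  have h := length_emitSumProd_le (fun i => (r, i)) (fun i => st.env (S.erase i)) S.toList st.gs
  rw [Finset.length_toList] at h
  exact h

/-- Processing a list of column sets of size `r + 1` adds at most `2(r+1)` gates per set.
[cite: JerrumSnir1982, §4.3 (p. 889)] -/
theorem length_foldl_processSubset_le (r : Fin n) :
    ∀ (l : List (Finset (Fin n))) (st : BState n), (∀ S ∈ l, S.card = (r : ℕ) + 1) →
      (l.foldl (processSubset r) st).gs.length ≤ st.gs.length + l.length * (2 * ((r : ℕ) + 1))
  | [], st, _ => by simp
  | S :: rest, st, hl => by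
    rw [List.foldl_cons]
    have h1 := length_processSubset_le r st S
    have h2 := length_foldl_processSubset_le r rest (processSubset r st S)
      (fun S' hS' => hl S' (List.mem_cons_of_mem _ hS'))
    rw [hl S List.mem_cons_self] at h1
    simp only [List.length_cons]
    nlinarith [h1, h2]

/-- Processing one level adds at most `C(n, r+1) · 2(r+1)` gates. [cite: JerrumSnir1982, §4.3 (p. 889)] -/
theorem length_processLevel_le (r : Fin n) (st : BState n) :
    (processLevel r st).gs.length ≤ st.gs.length + n.choose ((r : ℕ) + 1) * (2 * ((r : ℕ) + 1)) := by
  have h := length_foldl_processSubset_le r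
    ((Finset.univ : Finset (Fin n)).powersetCard ((r : ℕ) + 1)).toList st
    (fun S hS => (Finset.mem_powersetCard.1 (Finset.mem_toList.1 hS)).2)
  rw [Finset.length_toList, Finset.card_powersetCard, Finset.card_univ, Fintype.card_fin] at h
  exact h

/-- Processing all remaining levels adds at most `Σ_{j ∈ [m, n)} C(n, j+1) · 2(j+1)` gates.
[cite: JerrumSnir1982, §4.3 (p. 889)] -/
theorem length_buildFrom_le (m : ℕ) (st : BState n) :
    (buildFrom m st).gs.length ≤
      st.gs.length + ∑ j ∈ Finset.Ico m n, n.choose (j + 1) * (2 * (j + 1)) := by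
  rw [buildFrom]
  split_ifs with h
  · have h1 := length_processLevel_le ⟨m, h⟩ st
    have h2 := length_buildFrom_le (m + 1) (processLevel ⟨m, h⟩ st)
    rw [Finset.sum_eq_sum_Ico_succ_bot h]
    simp only at h1
    omega
  · simp
termination_by n - m

/-- **The size of the permanental Laplace circuit**: at most `n · 2^n` gates (exactly
`Σ_{r=2}^{n} (2r - 1)·C(n,r)`; JS count `n(2^{n-1} - 1)` of its product gates, each followed by at
most one plain sum gate). [cite: JerrumSnir1982, §4.3 (p. 889)] -/
theorem size_laplaceCircuit_le (hn : 0 < n) : (laplaceCircuit hn).size ≤ n * 2 ^ n := by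
  have h := length_buildFrom_le 1 (⟨[], initEnv hn⟩ : BState n)
  simp only [List.length_nil, zero_add] at h
  have hsum : ∑ j ∈ Finset.Ico 1 n, n.choose (j + 1) * (2 * (j + 1)) =
      2 * (n * (2 ^ (n - 1) - 1)) := by
    rw [← sum_Ico_choose_mul hn, Finset.mul_sum]
    refine Finset.sum_congr rfl fun j _ => ?_
    ring
  rw [hsum] at h
  have h2 : 2 * (n * (2 ^ (n - 1) - 1)) ≤ n * 2 ^ n := by
    have hp : 2 ^ n = 2 * 2 ^ (n - 1) := by
      rw [← pow_succ']; congr 1; omega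
    rw [hp]
    have := Nat.sub_le (2 ^ (n - 1)) 1
    nlinarith [this]
  exact le_trans h h2

end Build

/-! ### Elementary estimates for the positive rung -/

/-- `m² ≤ 2 · 2^m`. [folklore] -/
theorem mul_self_le_two_mul_two_pow : ∀ m : ℕ, m * m ≤ 2 * 2 ^ m
  | 0 => by norm_num
  | 1 => by norm_num
  | (m + 2) => by
    have ih := mul_self_le_two_mul_two_pow (m + 1)
    have h2 : m + 1 < 2 ^ (m + 1) := Nat.lt_two_pow_self
    calc (m + 2) * (m + 2) = (m + 1) * (m + 1) + 2 * (m + 1) + 1 := by ring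
      _ ≤ 2 * 2 ^ (m + 1) + 2 * (m + 1) + 1 := by omega
      _ ≤ 2 * 2 ^ (m + 1) + 2 * 2 ^ (m + 1) := by omega
      _ = 2 * 2 ^ (m + 2) := by ring

/-- The counting estimate of the positive rung in natural numbers: with `n = qk + r`, `r < k`,
`2^k ≤ n` (so `k ≤ log₂ n`), `(k+1)^n ≤ 2^{5n} · (k!)^q`; i.e. `(k!)^q ≥ 2^{n log₂(k+1) - 5n}`.
[folklore] -/
theorem succ_pow_le_two_pow_mul_factorial_pow {q k r : ℕ} (hk : 1 ≤ k) (hr : r < k)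
    (h2k : 2 ^ k ≤ q * k + r) :
    (k + 1) ^ (q * k + r) ≤ 2 ^ (5 * (q * k + r)) * k.factorial ^ q := by
  have hA : k ^ k ≤ 3 ^ k * k.factorial :=
    Literature.Combinatorics.Expanders.pow_self_le_three_pow_mul_factorial k
  have hkpow : k ^ (q * k + r) = (k ^ k) ^ q * k ^ r := by
    rw [pow_add, mul_comm q k, pow_mul]
  have hB : k ^ r ≤ 4 ^ (q * k + r) := by
    calc k ^ r ≤ k ^ k := Nat.pow_le_pow_right hk hr.le
      _ ≤ (2 ^ k) ^ k := Nat.pow_le_pow_left Nat.lt_two_pow_self.le k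
      _ = 2 ^ (k * k) := by rw [← pow_mul]
      _ ≤ 2 ^ (2 * 2 ^ k) := Nat.pow_le_pow_right (by norm_num) (mul_self_le_two_mul_two_pow k)
      _ ≤ 2 ^ (2 * (q * k + r)) := Nat.pow_le_pow_right (by norm_num) (by omega)
      _ = 4 ^ (q * k + r) := by rw [pow_mul]; norm_num
  have hC : 3 ^ (k * q) ≤ 4 ^ (q * k + r) := by
    calc 3 ^ (k * q) ≤ 3 ^ (q * k + r) :=
          Nat.pow_le_pow_right (by norm_num) (by rw [mul_comm]; omega)
      _ ≤ 4 ^ (q * k + r) := Nat.pow_le_pow_left (by norm_num) _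
  set n := q * k + r with hn
  calc (k + 1) ^ n ≤ (2 * k) ^ n := Nat.pow_le_pow_left (by omega) n
    _ = 2 ^ n * ((k ^ k) ^ q * k ^ r) := by rw [mul_pow, hkpow]
    _ ≤ 2 ^ n * ((3 ^ k * k.factorial) ^ q * 4 ^ n) := by gcongr
    _ = 2 ^ n * 3 ^ (k * q) * 4 ^ n * k.factorial ^ q := by rw [mul_pow, ← pow_mul]; ring
    _ ≤ 2 ^ n * 4 ^ n * 4 ^ n * k.factorial ^ q := by gcongr
    _ = 2 ^ (5 * n) * k.factorial ^ q := by
        rw [pow_mul, show (2 : ℕ) ^ 5 = 2 * 4 * 4 by norm_num, mul_pow, mul_pow]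

/-- The size estimate of the positive rung: `q · (k · 2^k) + q + r + 1 ≤ n^5 + 5` for `n = qk + r`,
`1 ≤ k`, `2^k ≤ n`, `4 ≤ n`. [folklore] -/
theorem blockSize_le {q k r : ℕ} (hk : 1 ≤ k) (h2k : 2 ^ k ≤ q * k + r) (h4 : 4 ≤ q * k + r) :
    q * (k * 2 ^ k) + q + r + 1 ≤ (q * k + r) ^ 5 + 5 := by
  set n := q * k + r with hn
  have hqk : q * k ≤ n := by omega
  have hq : q ≤ q * k := Nat.le_mul_of_pos_right q hk
  have h1 : q * (k * 2 ^ k) ≤ n * n := by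
    rw [← mul_assoc]; exact Nat.mul_le_mul hqk h2k
  have h2 : q + r + 1 ≤ n + 1 := by omega
  have h3 : n * n + (n + 1) ≤ n ^ 5 + 5 := by
    have h5 : n ^ 5 = n * n * (n * n * n) := by ring
    have : 16 ≤ n * n := by nlinarith
    have : 4 * (n * n) ≤ n * n * n := by nlinarith
    nlinarith
  omega

/-- The counting estimate in the real form of the item: from `log₂ n < k + 1`,
`(k+1)^n ≤ 2^{5n} (k!)^q` and `(k!)^q ≤ N` conclude `2^{n·log₂log₂ n - 5n} ≤ N`. [folklore] -/
theorem two_rpow_loglog_le {n k q N : ℕ} (hn : 2 ≤ n) (hlog : Real.logb 2 (n : ℝ) < (k : ℝ) + 1)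
    (hnat : (k + 1) ^ n ≤ 2 ^ (5 * n) * k.factorial ^ q) (hN : k.factorial ^ q ≤ N) :
    (2 : ℝ) ^ ((n : ℝ) * Real.logb 2 (Real.logb 2 (n : ℝ)) - ((5 : ℕ) : ℝ) * (n : ℝ)) ≤ (N : ℝ) := by
  have hx0 : 0 < Real.logb 2 (n : ℝ) := Real.logb_pos (by norm_num) (by exact_mod_cast hn)
  set x := Real.logb 2 (n : ℝ) with hx
  have h1 : (2 : ℝ) ^ ((n : ℝ) * Real.logb 2 x - ((5 : ℕ) : ℝ) * (n : ℝ)) = x ^ n / 2 ^ (5 * n) := by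
    rw [Real.rpow_sub (by norm_num : (0:ℝ) < 2), mul_comm (n : ℝ),
      Real.rpow_mul (by norm_num : (0:ℝ) ≤ 2), Real.rpow_logb (by norm_num) (by norm_num) hx0,
      Real.rpow_natCast]
    congr 1
    rw [show ((5 : ℕ) : ℝ) * (n : ℝ) = ((5 * n : ℕ) : ℝ) by push_cast; ring, Real.rpow_natCast]
  rw [h1, div_le_iff₀ (by positivity)]
  calc x ^ n ≤ ((k + 1 : ℕ) : ℝ) ^ n := by
        refine pow_le_pow_left₀ hx0.le ?_ n
        push_cast
        exact hlog.le
    _ ≤ ((2 ^ (5 * n) * k.factorial ^ q : ℕ) : ℝ) := by exact_mod_cast hnat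
    _ ≤ (N : ℝ) * 2 ^ (5 * n) := by
        rw [mul_comm]
        push_cast
        gcongr
        exact_mod_cast hN

/-- `log₂ n < ⌊log₂ n⌋ + 1` in the form needed: `Real.logb 2 n < Nat.log 2 n + 1`. [folklore] -/
theorem logb_lt_natLog_add_one {n : ℕ} (hn : 1 ≤ n) :
    Real.logb 2 (n : ℝ) < (Nat.log 2 n : ℝ) + 1 := by
  have hlt : n < 2 ^ (Nat.log 2 n + 1) := Nat.lt_pow_succ_log_self (by norm_num) n
  rw [Real.logb_lt_iff_lt_rpow (by norm_num) (by exact_mod_cast hn)]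
  rw [show (Nat.log 2 n : ℝ) + 1 = ((Nat.log 2 n + 1 : ℕ) : ℝ) by push_cast; ring,
    Real.rpow_natCast]
  exact_mod_cast hlt

end Summit.ValiantsHypothesis.Theorems.SummationBits
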